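import Summits.FinalStateConjecture.FinalStateConjecture.Theorems.EIHFluxBalanceInertialRecessionStubQuasiStationarityStabiliser
import Summits.FinalStateConjecture.FinalStateConjecture.Theorems.EIHFluxBalanceInertialRecessionSlavingFarFieldVarCalculus
import Literature.Geometry.Lorentzian.SchwarzschildKerrSchildComponents
import Literature.Geometry.Lorentzian.SchwarzschildKillingAlgebraProofs
import Summits.FinalStateConjecture.FinalStateConjecture.Theorems.EIHFluxBalanceInertialRecessionSlavingSpatialRigidity
import Summits.FinalStateConjecture.FinalStateConjecture.Theorems.EIHFluxBalanceInertialRecessionStubRechartTransportLaw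

/-!
# Route EIHFluxBalance — `InertialRecession` (E′), line `SketchCleanExcision`, skeleton r13,
# stub `stub_coerMomKernel` (Bk), part 6a: COVARIANCE of the far-field objects under rest
# isometries fixing the time axis and under lab isometries preserving the slice

Helper file for the crux `stmt-FinalStateConjecture-17403`
(`Summit.FinalStateConjecture.FinalStateConjecture.Theses.EIHFluxBalance.InertialRecession`, E′),
registered stub `stub_coerMomKernel` (Bk) of skeleton r13 (seat 1).

The flat far-field identities of Bk (parts 1–5) hold for the frame operator `S = Λ⁻¹` of an
ARBITRARY `Λ ∈ O(1,3)`; the far-field tables (…SlavingFarFieldRows*, …SpinRows*) are written for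
the frame `S₀ = boost(v e₁)⁻¹`. Writing `S = R ∘ S₀ ∘ N` (part 7) with `R` an `η`-isometry fixing
`e₀` (rest side) and `N` a lab isometry preserving the slice `{x⁰ = 0}`, this file moves `R` and
`N` through the objects:

* rest maps (`R` `η`-isometry, `R e₀ = e₀`): `bk_restMap_apply_zero`, `bk_restMap_sdot`,
  `bk_restMap_spatialNorm`, `bk_restMap_ell`, `bk_restMap_fderiv_bilin` (the DERIVATIVE of the
  Schwarzschild components is isotropy-invariant, from `schwarzschild_isotropy`), and
  **`bk_restMap_lieVar`**: the first-variation field with frame `R ∘ L₀` and motion `(A, d)` is the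
  one with frame `L₀` and the conjugate motion `(R⁻¹AR, R⁻¹d)`;
* lab maps: `bk_lieVar_comp_lab` (frame `L₀ ∘ N` = pull-back by `N`), `bk_fderiv_pullback_apply`,
  `bk_fderiv_comp_lab_scalar` (chain rules);
* lab isometries with `N² = 1`, `N e₀ = ±e₀`: `bk_labIso_apply_succ_zero`, `bk_labIso_symm`,
  `bk_labIso_cols`, **`bk_labIso_trace`**, `bk_labIso_trace₃` — `Σᵢ B(Neᵢ, Neᵢ) = Σᵢ B(eᵢ, eᵢ)`
  over the spatial coordinate vectors (the flat momentum operator is frame-independent),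
  `bk_labIso_apply_zero_of_spatial`.

No definitions, no named facts, no `sorry`.
-/

set_option linter.dupNamespace false
set_option maxSynthPendingDepth 3

noncomputable section

open Set Function Filter ContinuousLinearMap Literature.Geometry.Lorentzian
  Literature.Geometry.Lorentzian.Schwarzschild
open scoped Topology ContDiff InnerProductSpace

namespace Summit.FinalStateConjecture.FinalStateConjecture.Theorems.SublinearIsFree.Slaving

/-! ### Coordinates and `η` -/

/-- `η(u, w) = −u⁰w⁰ + ⟪u⃗, w⃗⟫`. [cite: ONeill1983, Ch. 3, p. 55] -/
theorem bk_minkowski_eq_sdot (u w : E4) : Minkowski.bilin u w = -(u 0 * w 0) + sdot u w := by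
  rw [Minkowski.bilin_apply, sdot]
  congr 1
  simp [PiLp.inner_apply, E4.spatial_apply, Fin.sum_univ_three, mul_comm]

/-! ### Rest maps: `η`-isometries fixing the time axis -/

section RestMap

variable {R : E4 →L[ℝ] E4}
  (hiso : ∀ u w : E4, Minkowski.bilin (R u) (R w) = Minkowski.bilin u w)
  (h0 : R (E4.basisVector 0) = E4.basisVector 0)
include hiso h0

/-- A rest map preserves time components: `(RU)⁰ = U⁰`. [cite: ONeill1983, Ch. 9, p. 233] -/
theorem bk_restMap_apply_zero (U : E4) : R U 0 = U 0 := by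
  have h := hiso U (E4.basisVector 0)
  rw [h0, Rechart.minkowski_basisVector_zero_right, Rechart.minkowski_basisVector_zero_right] at h
  linarith

/-- A rest map preserves the spatial pairing: `⟪(Rq)⃗, (RU)⃗⟫ = ⟪q⃗, U⃗⟫`. [cite: ONeill1983, Ch. 9, p. 233] -/
theorem bk_restMap_sdot (q U : E4) : sdot (R q) (R U) = sdot q U := by
  have h := hiso q U
  rw [bk_minkowski_eq_sdot, bk_minkowski_eq_sdot, bk_restMap_apply_zero hiso h0,
    bk_restMap_apply_zero hiso h0] at h
  linarith

/-- A rest map preserves the spatial radius: `‖(Rq)⃗‖ = ‖q⃗‖`. [cite: ONeill1983, Ch. 9, p. 233] -/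
theorem bk_restMap_spatialNorm (q : E4) : E4.spatialNorm (R q) = E4.spatialNorm q := by
  have h1 : E4.spatialNorm (R q) ^ 2 = E4.spatialNorm q ^ 2 := by
    rw [spatialNorm_sq_eq_sdot, spatialNorm_sq_eq_sdot, bk_restMap_sdot hiso h0]
  exact (pow_left_inj₀ (E4.spatialNorm_nonneg _) (E4.spatialNorm_nonneg _) two_ne_zero).1 h1

/-- A rest map preserves the Schwarzschild Kerr–Schild covector: `ℓ_{Rq}(RU) = ℓ_q(U)`. [folklore] -/
theorem bk_restMap_ell (q U : E4) : ell (R q) (R U) = ell q U := by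
  rw [ell, ell, bk_restMap_apply_zero hiso h0, bk_restMap_sdot hiso h0, bk_restMap_spatialNorm hiso h0]

/-- A rest map preserves the Schwarzschild Kerr–Schild radius. [folklore] -/
theorem bk_restMap_radius (q : E4) : Kerr.radius 0 (R q) = Kerr.radius 0 q := by
  rw [Kerr.radius_zero_left, Kerr.radius_zero_left, bk_restMap_spatialNorm hiso h0]

/-- **The derivative of the Schwarzschild components is isotropy-invariant**:
`Dg_{M,0}(Rq)(RX)(RU, RW) = Dg_{M,0}(q)(X)(U, W)` off the time axis (differentiate
`g(R·)(R·,R·) = g`, `schwarzschild_isotropy`). [cite: KerrSchild1965, §2] -/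
theorem bk_restMap_fderiv_bilin (M : ℝ) {q : E4} (hq : 0 < Kerr.radius 0 q) (X U W : E4) :
    fderiv ℝ (Kerr.bilin M 0) (R q) (R X) (R U) (R W) = fderiv ℝ (Kerr.bilin M 0) q X U W := by
  have hfun : (fun p : E4 ↦ (Kerr.bilin M 0 (R p)).bilinearComp R R) = Kerr.bilin M 0 := by
    funext p
    ext u w
    simp only [ContinuousLinearMap.bilinearComp_apply]
    exact QuasiStationarity.schwarzschild_isotropy (R := ⇑R) hiso h0 M p u w
  have hRq : 0 < Kerr.radius 0 (R q) := by rwa [bk_restMap_radius hiso h0]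
  have hd : DifferentiableAt ℝ (Kerr.bilin M 0) (R q) :=
    (Kerr.contDiffAt_bilin M 0 hRq (n := 1)).differentiableAt one_ne_zero
  have hT : HasFDerivAt (fun p : E4 ↦ Kerr.bilin M 0 (R p)) ((fderiv ℝ (Kerr.bilin M 0) (R q)).comp R) q :=
    hd.hasFDerivAt.comp q R.hasFDerivAt
  have hder := hasFDerivAt_bilinearComp_const hT R R
  rw [hfun] at hder
  rw [hder.fderiv]
  simp only [ContinuousLinearMap.comp_apply, ContinuousLinearMap.compL_apply, ContinuousLinearMap.flip_apply]

/-- **The first-variation field under a rest map.** For the frame `T = R ∘ L₀`, a motion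
`(A, d)` and `R⁻¹` a right inverse of `R`: off the painted time axis,
`Var(g_{M,0}; A, d; R ∘ L₀) = Var(g_{M,0}; R⁻¹AR, R⁻¹d; L₀)` — the rest map is invisible to the
Schwarzschild field up to conjugation of the motion. [cite: KerrSchild1965, §2] -/
theorem bk_restMap_lieVar (M : ℝ) {Rinv : E4 →L[ℝ] E4} (h1 : ∀ w : E4, R (Rinv w) = w)
    (L₀ A T : E4 →L[ℝ] E4) (d : E4) (hT : ∀ v : E4, T v = R (L₀ v)) {z : E4}
    (hz : 0 < Kerr.radius 0 (L₀ z)) :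
    (fderiv ℝ (Kerr.bilin M 0) (T z) (A (T z) + d)).bilinearComp T T
        + (Kerr.bilin M 0 (T z)).bilinearComp (A.comp T) T
        + (Kerr.bilin M 0 (T z)).bilinearComp T (A.comp T)
      = (fderiv ℝ (Kerr.bilin M 0) (L₀ z) (((Rinv.comp A).comp R) (L₀ z) + Rinv d)).bilinearComp L₀ L₀
        + (Kerr.bilin M 0 (L₀ z)).bilinearComp (((Rinv.comp A).comp R).comp L₀) L₀
        + (Kerr.bilin M 0 (L₀ z)).bilinearComp L₀ (((Rinv.comp A).comp R).comp L₀) := by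
  ext u w
  simp only [_root_.add_apply, ContinuousLinearMap.bilinearComp_apply, ContinuousLinearMap.coe_comp,
    comp_apply, hT]
  have e1 : A (R (L₀ z)) + d = R (Rinv (A (R (L₀ z))) + Rinv d) := by rw [← map_add, h1]
  have t1 : fderiv ℝ (Kerr.bilin M 0) (R (L₀ z)) (A (R (L₀ z)) + d) (R (L₀ u)) (R (L₀ w))
      = fderiv ℝ (Kerr.bilin M 0) (L₀ z) (Rinv (A (R (L₀ z))) + Rinv d) (L₀ u) (L₀ w) := by
    rw [e1]; exact bk_restMap_fderiv_bilin hiso h0 M hz _ _ _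
  have t2 : Kerr.bilin M 0 (R (L₀ z)) (A (R (L₀ u))) (R (L₀ w))
      = Kerr.bilin M 0 (L₀ z) (Rinv (A (R (L₀ u)))) (L₀ w) := by
    conv_lhs => rw [← h1 (A (R (L₀ u)))]
    exact QuasiStationarity.schwarzschild_isotropy (R := ⇑R) hiso h0 M _ _ _
  have t3 : Kerr.bilin M 0 (R (L₀ z)) (R (L₀ u)) (A (R (L₀ w)))
      = Kerr.bilin M 0 (L₀ z) (L₀ u) (Rinv (A (R (L₀ w)))) := by
    conv_lhs => rw [← h1 (A (R (L₀ w)))]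
    exact QuasiStationarity.schwarzschild_isotropy (R := ⇑R) hiso h0 M _ _ _
  rw [t1, t2, t3]

end RestMap

/-! ### Lab maps: frames `L₀ ∘ N` and pull-backs -/

/-- **The first-variation field for the frame `L₀ ∘ N` is the pull-back by `N`** of the one for
the frame `L₀` (for any components `K` and motion `(A, d)`). [folklore] -/
theorem bk_lieVar_comp_lab (K : E4 → E4 →L[ℝ] E4 →L[ℝ] ℝ) (L₀ N A T : E4 →L[ℝ] E4) (d z : E4)
    (hT : ∀ v : E4, T v = L₀ (N v)) :
    (fderiv ℝ K (T z) (A (T z) + d)).bilinearComp T T + (K (T z)).bilinearComp (A.comp T) T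
        + (K (T z)).bilinearComp T (A.comp T)
      = ((fderiv ℝ K (L₀ (N z)) (A (L₀ (N z)) + d)).bilinearComp L₀ L₀
          + (K (L₀ (N z))).bilinearComp (A.comp L₀) L₀
          + (K (L₀ (N z))).bilinearComp L₀ (A.comp L₀)).bilinearComp N N := by
  ext u w
  simp only [_root_.add_apply, ContinuousLinearMap.bilinearComp_apply, ContinuousLinearMap.coe_comp,
    comp_apply, hT]

/-- **Derivative of a pulled-back field**: `D(z ↦ F(Nz)(N·,N·))(x)(X)(U,W) = DF(Nx)(NX)(NU,NW)`.
[folklore] -/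
theorem bk_fderiv_pullback_apply {F : E4 → E4 →L[ℝ] E4 →L[ℝ] ℝ} (N : E4 →L[ℝ] E4) {x : E4}
    (hF : DifferentiableAt ℝ F (N x)) (X U W : E4) :
    fderiv ℝ (fun z : E4 ↦ (F (N z)).bilinearComp N N) x X U W = fderiv ℝ F (N x) (N X) (N U) (N W) := by
  have hT : HasFDerivAt (fun z : E4 ↦ F (N z)) ((fderiv ℝ F (N x)).comp N) x :=
    hF.hasFDerivAt.comp x N.hasFDerivAt
  rw [(hasFDerivAt_bilinearComp_const hT N N).fderiv]
  simp only [ContinuousLinearMap.comp_apply, ContinuousLinearMap.compL_apply, ContinuousLinearMap.flip_apply]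

/-- **Chain rule for scalar fields along a lab map**: `D(φ ∘ N)(x)(w) = Dφ(Nx)(Nw)`. [folklore] -/
theorem bk_fderiv_comp_lab_scalar {φ : E4 → ℝ} (N : E4 →L[ℝ] E4) {x : E4}
    (hφ : DifferentiableAt ℝ φ (N x)) (w : E4) :
    fderiv ℝ (fun z : E4 ↦ φ (N z)) x w = fderiv ℝ φ (N x) (N w) := by
  rw [show (fun z : E4 ↦ φ (N z)) = φ ∘ ⇑N from rfl, fderiv_comp x hφ N.differentiableAt, N.fderiv]
  rfl

/-! ### Lab isometries preserving the slice: spatial trace invariance -/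

section LabIso

variable {N : E4 →L[ℝ] E4}
  (hiso : ∀ u w : E4, Minkowski.bilin (N u) (N w) = Minkowski.bilin u w)
  (hN2 : ∀ w : E4, N (N w) = w)
  (hN0 : N (E4.basisVector 0) = E4.basisVector 0 ∨ N (E4.basisVector 0) = -E4.basisVector 0)
include hiso

section
include hN0

/-- A slice-preserving lab isometry maps spatial coordinate vectors to spatial vectors. [folklore] -/
theorem bk_labIso_apply_succ_zero (i : Fin 3) : N (E4.basisVector i.succ) 0 = 0 := by
  have h := hiso (E4.basisVector i.succ) (E4.basisVector 0)
  rcases hN0 with h0 | h0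
  · rw [h0] at h
    simp [Minkowski.bilin_apply, Fin.succ_ne_zero] at h
    linarith
  · rw [h0] at h
    simp [Minkowski.bilin_apply, Fin.succ_ne_zero] at h
    linarith

end

/-- **Column orthonormality** of the spatial block: `Σ_k (Ne_{i+1})_{k+1}(Ne_{j+1})_{k+1} = δᵢⱼ`.
[cite: ONeill1983, Ch. 9, p. 233] -/
theorem bk_labIso_cols (hN0 : N (E4.basisVector 0) = E4.basisVector 0 ∨ N (E4.basisVector 0) = -E4.basisVector 0)
    (i j : Fin 3) :
    N (E4.basisVector i.succ) 1 * N (E4.basisVector j.succ) 1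
      + N (E4.basisVector i.succ) 2 * N (E4.basisVector j.succ) 2
      + N (E4.basisVector i.succ) 3 * N (E4.basisVector j.succ) 3
      = if i = j then 1 else 0 := by
  have h := hiso (E4.basisVector i.succ) (E4.basisVector j.succ)
  rw [bk_minkowski_eq_sdot, bk_labIso_apply_succ_zero hiso hN0 i, zero_mul, neg_zero, zero_add,
    sdot_eq, minkowski_basisVector_succ] at h
  rw [h]
  fin_cases i <;> fin_cases j <;> simp

include hN2 in
/-- **Symmetry** of the spatial block of an involutive isometry: `(Ne_{j+1})_{i+1} = (Ne_{i+1})_{j+1}`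
(`η(Nu, w) = η(u, Nw)`). [folklore] -/
theorem bk_labIso_symm (i j : Fin 3) :
    N (E4.basisVector j.succ) i.succ = N (E4.basisVector i.succ) j.succ := by
  have h := hiso (E4.basisVector j.succ) (N (E4.basisVector i.succ))
  rw [hN2, minkowski_basisVector_succ, Minkowski.bilin_symm, minkowski_basisVector_succ] at h
  exact h

include hN2 in
/-- **Spatial trace invariance**: for every bilinear form `B` on `E4`,
`Σᵢ B(Ne_{i+1}, Ne_{i+1}) = Σᵢ B(e_{i+1}, e_{i+1})` — the rows of the spatial block of an involutive
slice-preserving isometry are orthonormal. [folklore] -/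
theorem bk_labIso_trace (hN0 : N (E4.basisVector 0) = E4.basisVector 0 ∨ N (E4.basisVector 0) = -E4.basisVector 0)
    (B : E4 →L[ℝ] E4 →L[ℝ] ℝ) :
    ∑ i : Fin 3, B (N (E4.basisVector i.succ)) (N (E4.basisVector i.succ))
      = ∑ i : Fin 3, B (E4.basisVector i.succ) (E4.basisVector i.succ) := by
  -- the spatial block `Q i j = (N e_{j+1})_{i+1}`
  have hvec : ∀ j : Fin 3, N (E4.basisVector j.succ) =
      N (E4.basisVector j.succ) 1 • E4.basisVector 1 + N (E4.basisVector j.succ) 2 • E4.basisVector 2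
        + N (E4.basisVector j.succ) 3 • E4.basisVector 3 := by
    intro j
    have h := QuasiStationarity.eq_sum_basisVector (N (E4.basisVector j.succ))
    rw [bk_labIso_apply_succ_zero hiso hN0 j, zero_smul, zero_add] at h
    exact h
  -- row orthonormality from column orthonormality and symmetry
  have hc := bk_labIso_cols hiso hN0
  have hs := bk_labIso_symm hiso hN2
  have r00 : N (E4.basisVector 1) 1 * N (E4.basisVector 1) 1 + N (E4.basisVector 1) 2 * N (E4.basisVector 1) 2
      + N (E4.basisVector 1) 3 * N (E4.basisVector 1) 3 = 1 := by simpa using hc 0 0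
  have r11 : N (E4.basisVector 2) 1 * N (E4.basisVector 2) 1 + N (E4.basisVector 2) 2 * N (E4.basisVector 2) 2
      + N (E4.basisVector 2) 3 * N (E4.basisVector 2) 3 = 1 := by simpa using hc 1 1
  have r22 : N (E4.basisVector 3) 1 * N (E4.basisVector 3) 1 + N (E4.basisVector 3) 2 * N (E4.basisVector 3) 2
      + N (E4.basisVector 3) 3 * N (E4.basisVector 3) 3 = 1 := by simpa using hc 2 2
  have r01 : N (E4.basisVector 1) 1 * N (E4.basisVector 2) 1 + N (E4.basisVector 1) 2 * N (E4.basisVector 2) 2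
      + N (E4.basisVector 1) 3 * N (E4.basisVector 2) 3 = 0 := by simpa using hc 0 1
  have r02 : N (E4.basisVector 1) 1 * N (E4.basisVector 3) 1 + N (E4.basisVector 1) 2 * N (E4.basisVector 3) 2
      + N (E4.basisVector 1) 3 * N (E4.basisVector 3) 3 = 0 := by simpa using hc 0 2
  have r12 : N (E4.basisVector 2) 1 * N (E4.basisVector 3) 1 + N (E4.basisVector 2) 2 * N (E4.basisVector 3) 2
      + N (E4.basisVector 2) 3 * N (E4.basisVector 3) 3 = 0 := by simpa using hc 1 2
  -- symmetry entries
  have s10 : N (E4.basisVector 1) 2 = N (E4.basisVector 2) 1 := by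
    have := hs 1 0; simpa using this
  have s20 : N (E4.basisVector 1) 3 = N (E4.basisVector 3) 1 := by
    have := hs 2 0; simpa using this
  have s21 : N (E4.basisVector 2) 3 = N (E4.basisVector 3) 2 := by
    have := hs 2 1; simpa using this
  simp only [Fin.sum_univ_three, Fin.succ_zero_eq_one, Fin.succ_one_eq_two]
  rw [show ((2 : Fin 3).succ : Fin 4) = 3 from rfl]
  have hv1 : N (E4.basisVector 1) = N (E4.basisVector 1) 1 • E4.basisVector 1
      + N (E4.basisVector 1) 2 • E4.basisVector 2 + N (E4.basisVector 1) 3 • E4.basisVector 3 := hvec 0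
  have hv2 : N (E4.basisVector 2) = N (E4.basisVector 2) 1 • E4.basisVector 1
      + N (E4.basisVector 2) 2 • E4.basisVector 2 + N (E4.basisVector 2) 3 • E4.basisVector 3 := hvec 1
  have hv3 : N (E4.basisVector 3) = N (E4.basisVector 3) 1 • E4.basisVector 1
      + N (E4.basisVector 3) 2 • E4.basisVector 2 + N (E4.basisVector 3) 3 • E4.basisVector 3 := hvec 2
  rw [hv1, hv2, hv3]
  simp only [map_add, map_smul, _root_.add_apply, _root_.smul_apply, smul_eq_mul]
  simp only [← s10, ← s20, ← s21] at r00 r11 r22 r01 r02 r12 ⊢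
  linear_combination (B (E4.basisVector 1) (E4.basisVector 1)) * r00
    + (B (E4.basisVector 2) (E4.basisVector 2)) * r11 + (B (E4.basisVector 3) (E4.basisVector 3)) * r22
    + (B (E4.basisVector 1) (E4.basisVector 2) + B (E4.basisVector 2) (E4.basisVector 1)) * r01
    + (B (E4.basisVector 1) (E4.basisVector 3) + B (E4.basisVector 3) (E4.basisVector 1)) * r02
    + (B (E4.basisVector 2) (E4.basisVector 3) + B (E4.basisVector 3) (E4.basisVector 2)) * r12


include hN2 in
/-- **Spatial trace invariance, first two slots of a trilinear form**:
`Σᵢ T(Ne_{i+1}, Ne_{i+1}, v) = Σᵢ T(e_{i+1}, e_{i+1}, v)`. [folklore] -/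
theorem bk_labIso_trace₃ (hN0 : N (E4.basisVector 0) = E4.basisVector 0 ∨ N (E4.basisVector 0) = -E4.basisVector 0)
    (T : E4 →L[ℝ] E4 →L[ℝ] E4 →L[ℝ] ℝ) (v : E4) :
    ∑ i : Fin 3, T (N (E4.basisVector i.succ)) (N (E4.basisVector i.succ)) v
      = ∑ i : Fin 3, T (E4.basisVector i.succ) (E4.basisVector i.succ) v := by
  have hvec : ∀ j : Fin 3, N (E4.basisVector j.succ) =
      N (E4.basisVector j.succ) 1 • E4.basisVector 1 + N (E4.basisVector j.succ) 2 • E4.basisVector 2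
        + N (E4.basisVector j.succ) 3 • E4.basisVector 3 := by
    intro j
    have h := QuasiStationarity.eq_sum_basisVector (N (E4.basisVector j.succ))
    rw [bk_labIso_apply_succ_zero hiso hN0 j, zero_smul, zero_add] at h
    exact h
  have hc := bk_labIso_cols hiso hN0
  have hs := bk_labIso_symm hiso hN2
  have r00 : N (E4.basisVector 1) 1 * N (E4.basisVector 1) 1 + N (E4.basisVector 1) 2 * N (E4.basisVector 1) 2
      + N (E4.basisVector 1) 3 * N (E4.basisVector 1) 3 = 1 := by simpa using hc 0 0
  have r11 : N (E4.basisVector 2) 1 * N (E4.basisVector 2) 1 + N (E4.basisVector 2) 2 * N (E4.basisVector 2) 2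
      + N (E4.basisVector 2) 3 * N (E4.basisVector 2) 3 = 1 := by simpa using hc 1 1
  have r22 : N (E4.basisVector 3) 1 * N (E4.basisVector 3) 1 + N (E4.basisVector 3) 2 * N (E4.basisVector 3) 2
      + N (E4.basisVector 3) 3 * N (E4.basisVector 3) 3 = 1 := by simpa using hc 2 2
  have r01 : N (E4.basisVector 1) 1 * N (E4.basisVector 2) 1 + N (E4.basisVector 1) 2 * N (E4.basisVector 2) 2
      + N (E4.basisVector 1) 3 * N (E4.basisVector 2) 3 = 0 := by simpa using hc 0 1
  have r02 : N (E4.basisVector 1) 1 * N (E4.basisVector 3) 1 + N (E4.basisVector 1) 2 * N (E4.basisVector 3) 2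
      + N (E4.basisVector 1) 3 * N (E4.basisVector 3) 3 = 0 := by simpa using hc 0 2
  have r12 : N (E4.basisVector 2) 1 * N (E4.basisVector 3) 1 + N (E4.basisVector 2) 2 * N (E4.basisVector 3) 2
      + N (E4.basisVector 2) 3 * N (E4.basisVector 3) 3 = 0 := by simpa using hc 1 2
  have s10 : N (E4.basisVector 1) 2 = N (E4.basisVector 2) 1 := by
    have := hs 1 0; simpa using this
  have s20 : N (E4.basisVector 1) 3 = N (E4.basisVector 3) 1 := by
    have := hs 2 0; simpa using this
  have s21 : N (E4.basisVector 2) 3 = N (E4.basisVector 3) 2 := by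
    have := hs 2 1; simpa using this
  simp only [Fin.sum_univ_three, Fin.succ_zero_eq_one, Fin.succ_one_eq_two]
  rw [show ((2 : Fin 3).succ : Fin 4) = 3 from rfl]
  have hv1 : N (E4.basisVector 1) = N (E4.basisVector 1) 1 • E4.basisVector 1
      + N (E4.basisVector 1) 2 • E4.basisVector 2 + N (E4.basisVector 1) 3 • E4.basisVector 3 := hvec 0
  have hv2 : N (E4.basisVector 2) = N (E4.basisVector 2) 1 • E4.basisVector 1
      + N (E4.basisVector 2) 2 • E4.basisVector 2 + N (E4.basisVector 2) 3 • E4.basisVector 3 := hvec 1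
  have hv3 : N (E4.basisVector 3) = N (E4.basisVector 3) 1 • E4.basisVector 1
      + N (E4.basisVector 3) 2 • E4.basisVector 2 + N (E4.basisVector 3) 3 • E4.basisVector 3 := hvec 2
  rw [hv1, hv2, hv3]
  simp only [map_add, map_smul, _root_.add_apply, _root_.smul_apply, smul_eq_mul]
  simp only [← s10, ← s20, ← s21] at r00 r11 r22 r01 r02 r12 ⊢
  linear_combination (T (E4.basisVector 1) (E4.basisVector 1) v) * r00
    + (T (E4.basisVector 2) (E4.basisVector 2) v) * r11 + (T (E4.basisVector 3) (E4.basisVector 3) v) * r22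
    + (T (E4.basisVector 1) (E4.basisVector 2) v + T (E4.basisVector 2) (E4.basisVector 1) v) * r01
    + (T (E4.basisVector 1) (E4.basisVector 3) v + T (E4.basisVector 3) (E4.basisVector 1) v) * r02
    + (T (E4.basisVector 2) (E4.basisVector 3) v + T (E4.basisVector 3) (E4.basisVector 2) v) * r12

include hN0 in
/-- A slice-preserving lab isometry maps spatial vectors to spatial vectors. [folklore] -/
theorem bk_labIso_apply_zero_of_spatial {w : E4} (hw : w 0 = 0) : N w 0 = 0 := by
  rw [QuasiStationarity.eq_sum_basisVector w, hw, zero_smul, zero_add]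
  simp only [map_add, map_smul, PiLp.add_apply, PiLp.smul_apply, smul_eq_mul]
  have h1 := bk_labIso_apply_succ_zero hiso hN0 0
  have h2 := bk_labIso_apply_succ_zero hiso hN0 1
  have h3 := bk_labIso_apply_succ_zero hiso hN0 2
  simp only [Fin.succ_zero_eq_one, Fin.succ_one_eq_two] at h1 h2 h3
  rw [show ((2 : Fin 3).succ : Fin 4) = 3 from rfl] at h3
  rw [h1, h2, h3]
  ring

end LabIso

/-- **Registered carrier** `bk_covA_carrier2` of the crux item (one-line form of
`bk_fderiv_comp_lab_scalar`, for the `--supports` protocol). [folklore] -/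
theorem bk_covA_carrier2 : open Literature.Geometry.Lorentzian in ∀ {φ : E4 → ℝ} (N : E4 →L[ℝ] E4) {x : E4}, DifferentiableAt ℝ φ (N x) → ∀ (w : E4), fderiv ℝ (fun z : E4 ↦ φ (N z)) x w = fderiv ℝ φ (N x) (N w) :=
  fun N _ hφ w ↦ bk_fderiv_comp_lab_scalar N hφ w

end Summit.FinalStateConjecture.FinalStateConjecture.Theorems.SublinearIsFree.Slaving

end
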